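import Summits.CriticalPhenomena.PercolationContinuityZ3.Theorems.PercNearOneGluingNoHeavyQuantGatedSliceWindow
import HarnessLib

/-!
# QUANT lane R8, T-DEC, leg (III), blob case — dual route: the CORRECTED law-level target `LawDec.GatedSliceMixLaw'` (the weak-mid law must
# itself be NON-DEC — exactly the lossless Gordan form the reduction uses); `GatedSliceMixLaw' → GatedSliceMixLaw`-free bookkeeping

builds on p205010 (kernel theorem, internal audit signed; external expert review pending)

Statement + support file (`--supports stmt-CriticalPhenomena-4575`), QUANT lane typer seat prim-quant-stmt (gen 29), rung R8 of
`run/shared/lean/prim/quant/LADDER.md`.  Memo `run/shared/lean/prim/quant/prim-quant-stmt-g29/GATED-SLICE-DUAL-G29.md` §8.  One `@[conjecture]`, no theorems.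

WHY THE CORRECTION (typer g29, same session as `…QuantGatedSliceWindow`).  `GatedSliceMixLaw` asks for `θ < 1` with `θ·W_h + (1−θ)·P[μ₂]` DEC for EVERY
`h ∈ (S, min(j,M)]`.  When `W_h` is ITSELF DEC but exactly tight and shares its only absorber with `P[μ₂]`, only `θ = 1` works: witness `M = 9, a = 2, j = 9,
y = 7/8, z = 0, g = 1, S = 63/8, h = 9, μ₂ = {1, 9; 55/64}` (`W_9 = δ₀/8 + 7δ₁₁/8` tight at `u = 7`; `P[μ₂] = 9δ₃/64 + 55δ₁₁/64` not DEC; both see only the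
giant `11`) — so `GatedSliceMixLaw` is FALSE as typed (`not_gatedSliceMixLaw`, companion file `…QuantGatedSliceMixLawRefutation`; the seat's earlier census had
allowed `θ = 1`).  The reduction `…QuantGatedSliceWindowReduction` only ever invokes the statement for a WEAK mid `h`, i.e. a price system `e` with `⟨e, W_h⟩ > 0`,
which forces `W_h ∉ D(t, j)` by weak duality.  With that hypothesis added the statement is, by Gordan's alternative, EXACTLY "every price system violated by `W_h`
is satisfied by `P[μ₂]`" — nothing is lost.  **`GatedSliceMixLaw'`** below is that statement; `gatedSliceWindowDEC_of_mixLaw'` (companion file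
`…QuantGatedSliceWindowReductionPrime`) re-runs the reduction from it.  EVIDENCE (exact LP with `θ < 1` ENFORCED, seat `explore/l4.py` rev. 2, `l4cex2.py`):
0 failures on 19 412 broad cases + 485 735 targeted cases in which `W_h` is deficient by construction (1 821 with both laws non-DEC) + the tight-`W` family; in
≈ 99.7 % of cases `θ = 0` works (`P[μ₂]` itself DEC — always so for `k₁ = 0`, the two-point instances of CW: `gatedSliceMixLaw_zero_ge`).
HONEST STATUS: `GatedSliceMixLaw'`, `GatedSliceWindowDEC`, `GateMove`, `GatedConvEmptyFree`, `SingleGateConvClosed`, `TreeDEC`, `FarTreeRow` OPEN; `GatedSliceMixLaw`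
FALSE; RATE class log* / honest sentence unchanged.

* **`LawDec.GatedSliceMixLaw'`** (`@[conjecture]`) — `GatedSliceMixLaw` with the extra hypothesis `¬ DECAtT y t j (M+a) (weakMidLaw S g h a)`.

[this work]; Gordan/Farkas [cite: Schrijver1986, Cor 7.1f (p. 90)].  The gluing rows served [cite: KozmaNitzan2024, Conjecture 3 (p. 15)]; product measure
[cite: Grimmett1999, §1.3 p. 10].
-/

noncomputable section

namespace Summit.CriticalPhenomena.PercolationContinuityZ3.Theorems

namespace Quant

open Finset

/-- the two-point law `{lo, hi; g}` (as in `…QuantLawDEC`) -/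
local notation3 "TP[" lo ", " hi ", " g ", " h "]" =>
  (g : ℝ) * (if (h : ℕ) = (hi : ℕ) then (1 : ℝ) else 0) + (1 - (g : ℝ)) * (if (h : ℕ) = (lo : ℕ) then (1 : ℝ) else 0)

namespace LawDec

/-- **CONJECTURE MW′ (the corrected mixing statement; typer g29).**  Frame of `GatedSliceMixLaw` (`0 < y < 1`, `0 ≤ z < 1`, `g ≤ 1`, `y ≤ (1−z)g`, `1 ≤ a`,
`j < M + a`, `0 < S`, `y·M ≤ S`, `t = S + ag(1−z)`); an atom `h` with `S < h ≤ min(j, M)` whose weak-mid law `W_h = weakMidLaw S g h a` is NOT DEC at `(y, t, j)`;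
a two-point law `μ₂ = {k₁, k₂; λ}` on `{0..M}` of mean `S/(1−z)`.  THEN some mixture `θ·W_h + (1−θ)·P[μ₂]` with `0 ≤ θ < 1` is DEC at `(y, t, j)` on `{0..M+a}`,
`P[μ₂] = zδ₀ + (1−z)·slice μ₂ a g`.  Equivalent (Gordan) to: every price system of the moved positions violated by `W_h` is satisfied by `P[μ₂]`.  With
`gatedSliceWindowDEC_of_mixLaw'` it implies `GatedSliceWindowDEC` and the blob case of leg (III).  EVIDENCE: file header.
builds on p205010 (kernel theorem, internal audit signed; external expert review pending). [this work] [status: open] -/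
@[conjecture] def GatedSliceMixLaw' : Prop :=
  ∀ (y z g S lam : ℝ) (a j M h k₁ k₂ : ℕ),
    0 < y → y < 1 → 0 ≤ z → z < 1 → g ≤ 1 → y ≤ (1 - z) * g → 1 ≤ a → j < M + a → 0 < S → y * (M : ℝ) ≤ S →
    h ≤ j → h ≤ M → S < (h : ℝ) →
    ¬ DECAtT y (S + (a : ℝ) * g * (1 - z)) j (M + a) (weakMidLaw S g h a) →
    k₁ ≤ k₂ → k₂ ≤ M → 0 ≤ lam → lam ≤ 1 → (1 - z) * ((k₁ : ℝ) + ((k₂ : ℝ) - k₁) * lam) = S →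
    ∃ θ : ℝ, 0 ≤ θ ∧ θ < 1 ∧
      DECAtT y (S + (a : ℝ) * g * (1 - z)) j (M + a)
        (fun p => θ * weakMidLaw S g h a p
          + (1 - θ) * (z * (if p = 0 then (1 : ℝ) else 0) + (1 - z) * slice (fun q => TP[k₁, k₂, lam, q]) a g p))

end LawDec

end Quant

end Summit.CriticalPhenomena.PercolationContinuityZ3.Theorems
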